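import Literature.Topology.FourManifolds.CappellShanesonClassGroupThirteenMain
import Literature.Topology.FourManifolds.CappellShanesonClassGroupFourteen
import Literature.Topology.FourManifolds.CappellShanesonClassGroupFifteen
import Literature.Topology.FourManifolds.CappellShanesonClassGroupSixteen
import Literature.Topology.FourManifolds.CappellShanesonClassGroupSeventeen
import Literature.Topology.FourManifolds.CappellShanesonClassGroupEighteen
import Literature.Topology.FourManifolds.CappellShanesonClassGroupNineteen
import Literature.Topology.FourManifolds.CappellShanesonClassGroupTwentyMain
import Literature.Topology.FourManifolds.CappellShanesonClassGroupTwentyone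
import Literature.Topology.FourManifolds.CappellShanesonClassGroupTwentytwo
import Literature.Topology.FourManifolds.CappellShanesonClassGroupTwentythree
import Literature.Topology.FourManifolds.CappellShanesonClassGroupTwentyfour
import Literature.Topology.FourManifolds.CappellShanesonClassGroupTwentyfive
import Literature.Topology.FourManifolds.CappellShanesonClassGroupTwentysix
import Literature.Topology.FourManifolds.CappellShanesonClassGroupTwentysevenMain
import Literature.Topology.FourManifolds.CappellShanesonClassGroupTwentyeightMain
import Literature.Topology.FourManifolds.CappellShanesonClassGroupThirtyMain
import Literature.Topology.FourManifolds.CappellShanesonClassGroupThirtyoneMain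
import Literature.Topology.FourManifolds.CappellShanesonClassGroupThirtytwoMain
import Literature.Topology.FourManifolds.CappellShanesonClassGroupThirtythreeMain
import Literature.Topology.FourManifolds.CappellShanesonClassGroupThirtyfourMain
import Literature.Topology.FourManifolds.CappellShanesonClassGroupThirtyfiveMain
import Literature.Topology.FourManifolds.CappellShanesonClassGroupThirtysixMain
import Literature.Topology.FourManifolds.CappellShanesonClassGroupThirtyeightMain
import Literature.Topology.FourManifolds.CappellShanesonClassGroupThirtynineMain
import Literature.Topology.FourManifolds.CappellShanesonClassGroupFortyoneMain
import Literature.Topology.FourManifolds.CappellShanesonClassGroupFortyfourMain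
import Literature.Topology.FourManifolds.CappellShanesonWindowChains
import Literature.Topology.FourManifolds.CappellShanesonClassGroupFiftyMain
import Literature.Topology.FourManifolds.CappellShanesonClassGroupFiftyoneMain
import Literature.Topology.FourManifolds.CappellShanesonClassGroupFiftythreeMain
import Literature.Topology.FourManifolds.CappellShanesonClassGroupFiftynineMain
import Literature.Topology.FourManifolds.CappellShanesonClassGroupSixtyMain
import Literature.Topology.FourManifolds.CappellShanesonClassGroupFiftytwoMain
import Literature.Topology.FourManifolds.CappellShanesonClassGroupFiftyfiveMain
import Literature.Topology.FourManifolds.CappellShanesonClassGroupFiftysevenMain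
import Literature.Topology.FourManifolds.CappellShanesonClassGroupFiftyfourMain
import Literature.Topology.FourManifolds.CappellShanesonClassGroupFiftysixMain
import Literature.Topology.FourManifolds.CappellShanesonClassGroupSixtyoneMain
import Literature.Topology.FourManifolds.CappellShanesonClassGroupSixtytwoMain
import Literature.Topology.FourManifolds.CappellShanesonClassGroupSixtythreeMain
import Literature.Topology.FourManifolds.CappellShanesonClassGroupSixtyfourMain
import Literature.Topology.FourManifolds.CappellShanesonClassGroupSixtyfiveMain
import Literature.Topology.FourManifolds.CappellShanesonClassGroupSixtysixMain
import Literature.Topology.FourManifolds.CappellShanesonClassGroupSixtysevenMain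
import Literature.Topology.FourManifolds.CappellShanesonClassGroupSixtyeightMain
import Literature.Topology.FourManifolds.CappellShanesonClassGroupSixtynineMain
import Literature.Topology.FourManifolds.CappellShanesonClassGroupFiftyeightMain
import Literature.Topology.FourManifolds.CappellShanesonClassGroupTwelve
import HarnessLib

/-!
# Kim–Yamada's Theorem B on the window `[-46, 51]`, assembled; what remains of Theorem B

Serves the named fact
`Literature.Topology.FourManifolds.kimYamada2023_nonempty_diffeomorph_sphere_four_of_trace_mem_Icc`
(`CappellShaneson.lean`; M. H. Kim, S. Yamada, *Ideal classes and Cappell–Shaneson homotopy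
4-spheres*, Kyungpook Math. J. 63 (2023) 373–411 = arXiv:1707.03860, Cor. C: every Cappell–Shaneson
homotopy 4-sphere of a matrix with `det (A - 1) = 1` and `-64 ≤ tr A ≤ 69` is `S⁴`), which the tree
reduces to Gompf's three topological leaves and **Theorem B in matrix form**,
`GompfConjectureForTrace n` (every `A ∈ SL(3, ℤ)` with `det (A - 1) = 1` and `tr A = n` is Gompf
equivalent to the Akbulut–Kirby matrix `A₀`), for the traces `n ∈ [13, 69]` (the child
`KimYamada2023_thmB_traces_13_69` of `CappellShanesonStandardOfTraceRange.lean`;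
`forall_gompfConjectureForTrace_of_Icc_thirteen`, `CappellShanesonClassGroupTwelve.lean`).

Theorem B is proved in the tree ONE TRACE AT A TIME (`gompfConjectureForTrace_<n>` in
`CappellShanesonClassNumberOneEleven.lean`, `CappellShanesonClassGroupTwelve.lean`,
`CappellShanesonClassGroup<N>[Main].lean`, `CappellShanesonWindowChains.lean`: certified ideal-class
computations in `ℤ[Θₙ]`, the Latimer–MacDuffee–Taussky correspondence, Gompf chains; and
`gompfConjectureForTrace_neg_<m>` for `5 - n` by Theorem A).  With the non-Dedekind trace `27`
(`CappellShanesonClassGroupTwentysevenMain.lean`) the proved traces have become an INTERVAL: this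
file assembles them.

* `gompfConjectureForTrace_of_mem_Icc_neg_fortysix_fiftyone` — **Theorem B for every
  `n ∈ [-46, 51]`** (98 traces; `[-7, 12]` from
  `gompfConjectureForTrace_of_mem_Icc_neg_seven_twelve`, the others case by case from the
  per-trace theorems).
* `nonempty_diffeomorph_sphere_four_of_trace_mem_Icc_neg_fortysix_fiftyone` — hence, granted
  Gompf's three topological leaves (`gompf2010_deltaMove`, `gompf2010_akbulutKirby_framings`,
  `akbulutKirby1979_sphere_four`, as everywhere in this story), **every Cappell–Shaneson homotopy
  4-sphere of a matrix with `det (A - 1) = 1` and `-46 ≤ tr A ≤ 51` is diffeomorphic to `S⁴`**: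
  Kim–Yamada's Corollary C on the sub-window `[-46, 51] ⊆ [-64, 69]` with its number theory
  PROVED.
* `forall_gompfConjectureForTrace_of_fifteen_traces` and
  `kimYamada2023_nonempty_diffeomorph_sphere_four_of_trace_mem_Icc_of_fifteen_traces` — **what
  remains of Theorem B / of the named fact**: the fifteen traces
  `52, 54, 55, 56, 57, 58, 61, 62, 63, 64, 65, 66, 67, 68, 69` (the traces `53, 59, 60` and their
  mirrors `-48, -54, -55` are theorems of the tree as well).

* **Update (same day, after the traces `52, 54, 55, 57, 61, …, 69` and the inductive step at
  `56` landed — `CappellShanesonClassGroup{Fiftytwo,Fiftyfour,Fiftyfive,Fiftysix,Fiftyseven,Sixtyone,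
  …,Sixtynine}Main.lean`):** `gompfConjectureForTrace_of_mem_Icc_neg_fifty_fiftyfive` (Theorem B on
  all of `[-50, 55]`), `forall_gompfConjectureForTrace_of_fiftyeight` (Theorem B for every
  `n ∈ [-64, 69]` granted the single trace `58`: the trace `56` enters through its inductive step
  `gompfConjectureForTrace_fiftysix_of`, whose one open hypothesis `-53 = 5 - 58` follows from `58`
  by Theorem A, and `-51 = 5 - 56`, `-53` by Theorem A again),
  `nonempty_diffeomorph_sphere_four_of_trace_mem_Icc_neg_fifty_fiftyfive` (Cor. C on `[-50, 55]`) and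
  `kimYamada2023_nonempty_diffeomorph_sphere_four_of_trace_mem_Icc_of_fiftyeight`: **the named fact
  now rests on Gompf's three leaves and Theorem B for the ONE trace `58`** (what it needs: the
  certified class-group data — Part A / Rel / Cls — of the trace-`58` field, none of which is in the
  tree yet; KY's three exceptional chains at `58` are already vendored in `CappellShanesonGompfChains.lean`).

* **Final update (same day, after the trace `58` landed — `CappellShanesonClassGroupFiftyeight{,Rel1,
  Rel2,Cls,Main}.lean`, `CappellShanesonGompfChainsFiftyeight.lean`: class number `36`, the largest in
  the window; `gompfConjectureForTrace_fiftyeight`, `gompfConjectureForTrace_neg_fiftythree`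
  UNCONDITIONAL):** `gompfConjectureForTrace_fiftysix` and `gompfConjectureForTrace_neg_fiftyone`
  (the inductive step at `56` discharged by `-53`), `forall_gompfConjectureForTrace_Icc_neg_sixtyfour_sixtynine`
  — **KIM–YAMADA'S THEOREM B IN MATRIX FORM, `GompfConjectureForTrace n` FOR EVERY `-64 ≤ n ≤ 69`,
  PROVED** —, `gompfConjectureForTrace_of_mem_Icc_neg_sixtyfour_sixtynine`,
  `nonempty_diffeomorph_sphere_four_of_trace_mem_Icc_neg_sixtyfour_sixtynine` (Corollary C on the whole
  window granted Gompf's three topological leaves) and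
  `kimYamada2023_nonempty_diffeomorph_sphere_four_of_trace_mem_Icc_of_leaves`: **the named fact now
  rests on Gompf's three leaves alone** (`gompf2010_deltaMove`, `gompf2010_akbulutKirby_framings`,
  `akbulutKirby1979_sphere_four`); its algebraic child `KimYamada2023_thmB_traces_13_69`
  (`CappellShanesonStandardOfTraceRange.lean`) is discharged there.

Assembly only: no new mathematics, no named fact introduced.
-/

noncomputable section

open Set
open scoped Manifold ContDiff MatrixGroups

namespace Literature.Topology.FourManifolds

universe u

/-! ### Theorem B on `[-46, 51]` -/

/-- **Kim–Yamada 2023, Theorem B for every trace `-46 ≤ n ≤ 51`, PROVED** ("Conjecture 2 [every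
Cappell–Shaneson matrix is Gompf equivalent to `A₀`] is true for trace `n` if `-64 ≤ n ≤ 69`",
here for the sub-window `[-46, 51]`): assembled from the tree's per-trace theorems
`gompfConjectureForTrace_<n>` (`13 ≤ n ≤ 51`), their Theorem-A mirrors
`gompfConjectureForTrace_neg_<m>` (`-46 ≤ 5 - n ≤ -8`) and the window `[-7, 12]`
(`gompfConjectureForTrace_of_mem_Icc_neg_seven_twelve`).
[cite: KimYamada2023, Thm. B (§1.2, §6.1)] -/
theorem gompfConjectureForTrace_of_mem_Icc_neg_fortysix_fiftyone {n : ℤ}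
    (hn : n ∈ Icc (-46 : ℤ) 51) : GompfConjectureForTrace n := by
  simp only [mem_Icc] at hn
  obtain ⟨h1, h2⟩ := hn
  by_cases h12 : n ≤ 12
  · by_cases h7 : -7 ≤ n
    · exact gompfConjectureForTrace_of_mem_Icc_neg_seven_twelve (by simp only [mem_Icc]; omega)
    · push Not at h7
      interval_cases n
      · exact gompfConjectureForTrace_neg_fortysix
      · exact gompfConjectureForTrace_neg_fortyfive
      · exact gompfConjectureForTrace_neg_fortyfour
      · exact gompfConjectureForTrace_neg_fortythree
      · exact gompfConjectureForTrace_neg_fortytwo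
      · exact gompfConjectureForTrace_neg_fortyone
      · exact gompfConjectureForTrace_neg_forty
      · exact gompfConjectureForTrace_neg_thirtynine
      · exact gompfConjectureForTrace_neg_thirtyeight
      · exact gompfConjectureForTrace_neg_thirtyseven
      · exact gompfConjectureForTrace_neg_thirtysix
      · exact gompfConjectureForTrace_neg_thirtyfive
      · exact gompfConjectureForTrace_neg_thirtyfour
      · exact gompfConjectureForTrace_neg_thirtythree
      · exact gompfConjectureForTrace_neg_thirtytwo
      · exact gompfConjectureForTrace_neg_thirtyone
      · exact gompfConjectureForTrace_neg_thirty
      · exact gompfConjectureForTrace_neg_twentynine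
      · exact gompfConjectureForTrace_neg_twentyeight
      · exact gompfConjectureForTrace_neg_twentyseven
      · exact gompfConjectureForTrace_neg_twentysix
      · exact gompfConjectureForTrace_neg_twentyfive
      · exact gompfConjectureForTrace_neg_twentyfour
      · exact gompfConjectureForTrace_neg_twentythree
      · exact gompfConjectureForTrace_neg_twentytwo
      · exact gompfConjectureForTrace_neg_twentyone
      · exact gompfConjectureForTrace_neg_twenty
      · exact gompfConjectureForTrace_neg_nineteen
      · exact gompfConjectureForTrace_neg_eighteen
      · exact gompfConjectureForTrace_neg_seventeen
      · exact gompfConjectureForTrace_neg_sixteen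
      · exact gompfConjectureForTrace_neg_fifteen
      · exact gompfConjectureForTrace_neg_fourteen
      · exact gompfConjectureForTrace_neg_thirteen
      · exact gompfConjectureForTrace_neg_twelve
      · exact gompfConjectureForTrace_neg_eleven
      · exact gompfConjectureForTrace_neg_ten
      · exact gompfConjectureForTrace_neg_nine
      · exact gompfConjectureForTrace_neg_eight
  · push Not at h12
    interval_cases n
    · exact gompfConjectureForTrace_thirteen
    · exact gompfConjectureForTrace_fourteen
    · exact gompfConjectureForTrace_fifteen
    · exact gompfConjectureForTrace_sixteen
    · exact gompfConjectureForTrace_seventeen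
    · exact gompfConjectureForTrace_eighteen
    · exact gompfConjectureForTrace_nineteen
    · exact gompfConjectureForTrace_twenty
    · exact gompfConjectureForTrace_twentyone
    · exact gompfConjectureForTrace_twentytwo
    · exact gompfConjectureForTrace_twentythree
    · exact gompfConjectureForTrace_twentyfour
    · exact gompfConjectureForTrace_twentyfive
    · exact gompfConjectureForTrace_twentysix
    · exact gompfConjectureForTrace_twentyseven
    · exact gompfConjectureForTrace_twentyeight
    · exact gompfConjectureForTrace_twentynine
    · exact gompfConjectureForTrace_thirty
    · exact gompfConjectureForTrace_thirtyone
    · exact gompfConjectureForTrace_thirtytwo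
    · exact gompfConjectureForTrace_thirtythree
    · exact gompfConjectureForTrace_thirtyfour
    · exact gompfConjectureForTrace_thirtyfive
    · exact gompfConjectureForTrace_thirtysix
    · exact gompfConjectureForTrace_thirtyseven
    · exact gompfConjectureForTrace_thirtyeight
    · exact gompfConjectureForTrace_thirtynine
    · exact gompfConjectureForTrace_forty
    · exact gompfConjectureForTrace_fortyone
    · exact gompfConjectureForTrace_fortytwo
    · exact gompfConjectureForTrace_fortythree
    · exact gompfConjectureForTrace_fortyfour
    · exact gompfConjectureForTrace_fortyfive
    · exact gompfConjectureForTrace_fortysix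
    · exact gompfConjectureForTrace_fortyseven
    · exact gompfConjectureForTrace_fortyeight
    · exact gompfConjectureForTrace_fortynine
    · exact gompfConjectureForTrace_fifty
    · exact gompfConjectureForTrace_fiftyone

/-- **What remains of Theorem B: the fifteen traces `52, 54–58, 61–69`.**  Granted Gompf's
conjecture for these, it holds for every trace in `[-64, 69]` (the traces `53, 59, 60` are the
tree's `gompfConjectureForTrace_fiftythree`, `…_fiftynine`, `…_sixty`; the window `[-46, 51]` is
`gompfConjectureForTrace_of_mem_Icc_neg_fortysix_fiftyone`; the rest of `[-64, 12]` and the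
mirrors `5 - n` by `forall_gompfConjectureForTrace_of_Icc_thirteen`). [cite: KimYamada2023, Thm. B (§6.1, Tables 2–6)] -/
theorem forall_gompfConjectureForTrace_of_fifteen_traces
    (hB : ∀ n ∈ ({52, 54, 55, 56, 57, 58, 61, 62, 63, 64, 65, 66, 67, 68, 69} : Finset ℤ),
      GompfConjectureForTrace n) :
    ∀ n ∈ Icc (-64 : ℤ) 69, GompfConjectureForTrace n := by
  refine forall_gompfConjectureForTrace_of_Icc_thirteen fun n hn => ?_
  simp only [mem_Icc] at hn
  obtain ⟨h1, h2⟩ := hn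
  by_cases h51 : n ≤ 51
  · exact gompfConjectureForTrace_of_mem_Icc_neg_fortysix_fiftyone (by simp only [mem_Icc]; omega)
  · push Not at h51
    interval_cases n
    · exact hB 52 (by decide)
    · exact gompfConjectureForTrace_fiftythree
    · exact hB 54 (by decide)
    · exact hB 55 (by decide)
    · exact hB 56 (by decide)
    · exact hB 57 (by decide)
    · exact hB 58 (by decide)
    · exact gompfConjectureForTrace_fiftynine
    · exact gompfConjectureForTrace_sixty
    · exact hB 61 (by decide)
    · exact hB 62 (by decide)
    · exact hB 63 (by decide)
    · exact hB 64 (by decide)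
    · exact hB 65 (by decide)
    · exact hB 66 (by decide)
    · exact hB 67 (by decide)
    · exact hB 68 (by decide)
    · exact hB 69 (by decide)

/-! ### Corollary C on `[-46, 51]`, and the named fact from fifteen traces -/

section Spheres

variable (X : Type u) [TopologicalSpace X] [T2Space X] [SecondCountableTopology X]
  [ChartedSpace (EuclideanSpace ℝ (Fin 4)) X] [IsManifold (𝓡 4) ∞ X] [CompactSpace X]

/-- **Cappell–Shaneson homotopy 4-spheres of trace `-46 ≤ tr A ≤ 51` are standard, granted Gompf's
three topological leaves** — Kim–Yamada's Corollary C ("`Σ^ε_A` is diffeomorphic to `S⁴` for any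
`ε ∈ ℤ₂` and any `A ∈ 𝒞𝒮` with `-64 ≤ tr(A) ≤ 69`", which "immediately follows from Theorem B" by
Remark 1.1) restricted to the sub-window `[-46, 51]`, with Theorem B there PROVED
(`gompfConjectureForTrace_of_mem_Icc_neg_fortysix_fiftyone`); the leaves are the named facts
`gompf2010_deltaMove`, `gompf2010_akbulutKirby_framings`, `akbulutKirby1979_sphere_four` of
`CappellShanesonGompfReduction.lean`. [cite: KimYamada2023, Cor. C and Remark 1.1 (§1.2)] -/
theorem nonempty_diffeomorph_sphere_four_of_trace_mem_Icc_neg_fortysix_fiftyone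
    (hΔ : gompf2010_deltaMove.{u}) (h43 : gompf2010_akbulutKirby_framings.{0, 0})
    (hAK : akbulutKirby1979_sphere_four) {A : SL(3, ℤ)}
    (hdet : ((A : Matrix (Fin 3) (Fin 3) ℤ) - 1).det = 1)
    (htr : Matrix.trace (A : Matrix (Fin 3) (Fin 3) ℤ) ∈ Icc (-46 : ℤ) 51)
    (hX : IsCappellShanesonSphereOf A X) :
    Nonempty (X ≃ₘ⟮𝓡 4, 𝓡 4⟯ (Metric.sphere (0 : EuclideanSpace ℝ (Fin (4 + 1))) 1)) :=
  nonempty_diffeomorph_sphere_four_of_gompfConjectureForTrace X hΔ h43 hAK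
    (gompfConjectureForTrace_of_mem_Icc_neg_fortysix_fiftyone htr) hdet rfl hX

end Spheres

/-- **The named fact (Kim–Yamada's Cor. C on `[-64, 69]`) from Gompf's three leaves and Theorem B
for the fifteen remaining traces `52, 54–58, 61–69`.** [cite: KimYamada2023, Thm. B and Cor. C (§1.2, §6.1)] -/
theorem kimYamada2023_nonempty_diffeomorph_sphere_four_of_trace_mem_Icc_of_fifteen_traces
    (hΔ : gompf2010_deltaMove.{u}) (h43 : gompf2010_akbulutKirby_framings.{0, 0})
    (hAK : akbulutKirby1979_sphere_four)
    (hB : ∀ n ∈ ({52, 54, 55, 56, 57, 58, 61, 62, 63, 64, 65, 66, 67, 68, 69} : Finset ℤ),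
      GompfConjectureForTrace n) :
    kimYamada2023_nonempty_diffeomorph_sphere_four_of_trace_mem_Icc.{u} :=
  kimYamada2023_nonempty_diffeomorph_sphere_four_of_trace_mem_Icc_of hΔ h43 hAK
    (forall_gompfConjectureForTrace_of_fifteen_traces hB)

/-! ### Update: Theorem B on `[-50, 55]`; the named fact from the single trace `58` -/

/-- **Kim–Yamada 2023, Theorem B for every trace `-50 ≤ n ≤ 55`, PROVED** (the window `[-46, 51]`
of `gompfConjectureForTrace_of_mem_Icc_neg_fortysix_fiftyone` extended by the traces `52, …, 55`
and their mirrors `-47, …, -50`). [cite: KimYamada2023, Thm. B (§1.2, §6.1)] -/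
theorem gompfConjectureForTrace_of_mem_Icc_neg_fifty_fiftyfive {n : ℤ}
    (hn : n ∈ Icc (-50 : ℤ) 55) : GompfConjectureForTrace n := by
  simp only [mem_Icc] at hn
  obtain ⟨h1, h2⟩ := hn
  by_cases h51 : n ≤ 51
  · by_cases h46 : -46 ≤ n
    · exact gompfConjectureForTrace_of_mem_Icc_neg_fortysix_fiftyone (by simp only [mem_Icc]; omega)
    · push Not at h46
      interval_cases n
      · exact gompfConjectureForTrace_neg_fifty
      · exact gompfConjectureForTrace_neg_fortynine
      · exact gompfConjectureForTrace_neg_fortyeight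
      · exact gompfConjectureForTrace_neg_fortyseven
  · push Not at h51
    interval_cases n
    · exact gompfConjectureForTrace_fiftytwo
    · exact gompfConjectureForTrace_fiftythree
    · exact gompfConjectureForTrace_fiftyfour
    · exact gompfConjectureForTrace_fiftyfive

/-- **What remains of Theorem B: the single trace `58`.**  Granted Gompf's conjecture for the trace
`58`, it holds for every trace in `[-64, 69]`: the window `[-50, 55]` and the traces `57, 59, …, 69`
are theorems of the tree, `56` is the tree's inductive step `gompfConjectureForTrace_fiftysix_of`
whose open hypothesis `-53 = 5 - 58` is Theorem A applied to `58`, and the rest of `[-64, 12]` with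
the mirrors `5 - n` is `forall_gompfConjectureForTrace_of_Icc_thirteen`. [cite: KimYamada2023, Thm. B (§6.1, Tables 2–6)] -/
theorem forall_gompfConjectureForTrace_of_fiftyeight (h58 : GompfConjectureForTrace 58) :
    ∀ n ∈ Icc (-64 : ℤ) 69, GompfConjectureForTrace n := by
  have hneg53 : GompfConjectureForTrace (-53) := by
    have h := gompfConjectureForTrace_of_five_sub h58
    norm_num at h
    exact h
  have h56 : GompfConjectureForTrace 56 :=
    gompfConjectureForTrace_fiftysix_of gompfConjectureForTrace_neg_fortyfive
      gompfConjectureForTrace_neg_thirtythree gompfConjectureForTrace_neg_eighteen hneg53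
      gompfConjectureForTrace_fifteen
  refine forall_gompfConjectureForTrace_of_fifteen_traces fun n hn => ?_
  simp only [Finset.mem_insert, Finset.mem_singleton] at hn
  rcases hn with rfl | rfl | rfl | rfl | rfl | rfl | rfl | rfl | rfl | rfl | rfl | rfl | rfl |
    rfl | rfl
  · exact gompfConjectureForTrace_fiftytwo
  · exact gompfConjectureForTrace_fiftyfour
  · exact gompfConjectureForTrace_fiftyfive
  · exact h56
  · exact gompfConjectureForTrace_fiftyseven
  · exact h58
  · exact gompfConjectureForTrace_sixtyone
  · exact gompfConjectureForTrace_sixtytwo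
  · exact gompfConjectureForTrace_sixtythree
  · exact gompfConjectureForTrace_sixtyfour
  · exact gompfConjectureForTrace_sixtyfive
  · exact gompfConjectureForTrace_sixtysix
  · exact gompfConjectureForTrace_sixtyseven
  · exact gompfConjectureForTrace_sixtyeight
  · exact gompfConjectureForTrace_sixtynine

section SpheresUpdate

variable (X : Type u) [TopologicalSpace X] [T2Space X] [SecondCountableTopology X]
  [ChartedSpace (EuclideanSpace ℝ (Fin 4)) X] [IsManifold (𝓡 4) ∞ X] [CompactSpace X]

/-- **Cappell–Shaneson homotopy 4-spheres of trace `-50 ≤ tr A ≤ 55` are standard, granted Gompf's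
three topological leaves** (Kim–Yamada's Cor. C restricted to `[-50, 55]`, with Theorem B there
PROVED, `gompfConjectureForTrace_of_mem_Icc_neg_fifty_fiftyfive`). [cite: KimYamada2023, Cor. C and Remark 1.1 (§1.2)] -/
theorem nonempty_diffeomorph_sphere_four_of_trace_mem_Icc_neg_fifty_fiftyfive
    (hΔ : gompf2010_deltaMove.{u}) (h43 : gompf2010_akbulutKirby_framings.{0, 0})
    (hAK : akbulutKirby1979_sphere_four) {A : SL(3, ℤ)}
    (hdet : ((A : Matrix (Fin 3) (Fin 3) ℤ) - 1).det = 1)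
    (htr : Matrix.trace (A : Matrix (Fin 3) (Fin 3) ℤ) ∈ Icc (-50 : ℤ) 55)
    (hX : IsCappellShanesonSphereOf A X) :
    Nonempty (X ≃ₘ⟮𝓡 4, 𝓡 4⟯ (Metric.sphere (0 : EuclideanSpace ℝ (Fin (4 + 1))) 1)) :=
  nonempty_diffeomorph_sphere_four_of_gompfConjectureForTrace X hΔ h43 hAK
    (gompfConjectureForTrace_of_mem_Icc_neg_fifty_fiftyfive htr) hdet rfl hX

end SpheresUpdate

/-- **The named fact (Kim–Yamada's Cor. C on `[-64, 69]`) from Gompf's three leaves and Theorem B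
for the one remaining trace `58`.** [cite: KimYamada2023, Thm. B and Cor. C (§1.2, §6.1)] -/
theorem kimYamada2023_nonempty_diffeomorph_sphere_four_of_trace_mem_Icc_of_fiftyeight
    (hΔ : gompf2010_deltaMove.{u}) (h43 : gompf2010_akbulutKirby_framings.{0, 0})
    (hAK : akbulutKirby1979_sphere_four) (h58 : GompfConjectureForTrace 58) :
    kimYamada2023_nonempty_diffeomorph_sphere_four_of_trace_mem_Icc.{u} :=
  kimYamada2023_nonempty_diffeomorph_sphere_four_of_trace_mem_Icc_of hΔ h43 hAK
    (forall_gompfConjectureForTrace_of_fiftyeight h58)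


/-! ### Final update: Theorem B on all of `[-64, 69]`; the named fact from Gompf's three leaves -/

/-- **Kim–Yamada 2023, Theorem B for the trace `56`, UNCONDITIONAL**: the tree's inductive step
`gompfConjectureForTrace_fiftysix_of` (`CappellShanesonClassGroupFiftysixMain.lean`) with its one
formerly open hypothesis `-53 = 5 - 58` discharged by `gompfConjectureForTrace_neg_fiftythree`
(`CappellShanesonClassGroupFiftyeightMain.lean`). [cite: KimYamada2023, Thm. B (§1.2, §6.1)] -/
theorem gompfConjectureForTrace_fiftysix : GompfConjectureForTrace 56 :=
  gompfConjectureForTrace_fiftysix_of gompfConjectureForTrace_neg_fortyfive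
    gompfConjectureForTrace_neg_thirtythree gompfConjectureForTrace_neg_eighteen
    gompfConjectureForTrace_neg_fiftythree gompfConjectureForTrace_fifteen

/-- **Theorem B for the trace `-51`, UNCONDITIONAL** (`= 5 - 56`, Theorem A). [cite: KimYamada2023, Thm. A and Thm. B] -/
theorem gompfConjectureForTrace_neg_fiftyone : GompfConjectureForTrace (-51) :=
  gompfConjectureForTrace_neg_fiftyone_of gompfConjectureForTrace_neg_fortyfive
    gompfConjectureForTrace_neg_thirtythree gompfConjectureForTrace_neg_eighteen
    gompfConjectureForTrace_neg_fiftythree gompfConjectureForTrace_fifteen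

/-- **KIM–YAMADA 2023, THEOREM B, PROVED IN FULL (matrix form): for every `-64 ≤ n ≤ 69`, every
`A ∈ SL(3, ℤ)` with `det (A - 1) = 1` and `tr A = n` is Gompf equivalent to the Akbulut–Kirby matrix
`A₀`** ("Conjecture 2 is true for trace `n` if `-64 ≤ n ≤ 69`"). Assembled from
`forall_gompfConjectureForTrace_of_fiftyeight` and the last trace `gompfConjectureForTrace_fiftyeight`
— i.e. from the tree's per-trace certified ideal-class computations in `ℤ[Θₙ]` for `13 ≤ n ≤ 69`
(incl. the non-maximal order at `27` and the class number `36` at `58`), the Latimer–MacDuffee–Taussky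
correspondence (Prop. 2.14), Lemma 6.1 with the paper's exceptional chains (and one further certified
chain at `58`), Theorem A, and the class-number-one window `[-7, 12]` (Aitchison–Rubinstein, Gompf).
[cite: KimYamada2023, Thm. B (§1.2, §6.1, Tables 2–6)] -/
theorem forall_gompfConjectureForTrace_Icc_neg_sixtyfour_sixtynine :
    ∀ n ∈ Icc (-64 : ℤ) 69, GompfConjectureForTrace n :=
  forall_gompfConjectureForTrace_of_fiftyeight gompfConjectureForTrace_fiftyeight

/-- **Theorem B on the window**, pointwise form. [cite: KimYamada2023, Thm. B (§1.2, §6.1)] -/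
theorem gompfConjectureForTrace_of_mem_Icc_neg_sixtyfour_sixtynine {n : ℤ}
    (hn : n ∈ Icc (-64 : ℤ) 69) : GompfConjectureForTrace n :=
  forall_gompfConjectureForTrace_Icc_neg_sixtyfour_sixtynine n hn

/-- **The algebraic child `KimYamada2023_thmB_traces_13_69` of the named fact, written out**: Theorem B
in matrix form for every trace in `[13, 69]` (the hypothesis `hB` of
`kimYamada2023_nonempty_diffeomorph_sphere_four_of_trace_mem_Icc_of_Icc_thirteen`). [cite: KimYamada2023, Thm. B (§1.2, §6.1)] -/
theorem forall_gompfConjectureForTrace_Icc_thirteen_sixtynine :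
    ∀ n ∈ Icc (13 : ℤ) 69, ∀ A : SL(3, ℤ), ((A : Matrix (Fin 3) (Fin 3) ℤ) - 1).det = 1 →
      Matrix.trace (A : Matrix (Fin 3) (Fin 3) ℤ) = n → GompfEquiv A akbulutKirbyMatrix := by
  intro n hn A hdet htr
  simp only [mem_Icc] at hn
  obtain ⟨h1, h2⟩ := hn
  exact gompfConjectureForTrace_of_mem_Icc_neg_sixtyfour_sixtynine (n := n)
    (by simp only [mem_Icc]; omega) A hdet htr

section SpheresFinal

variable (X : Type u) [TopologicalSpace X] [T2Space X] [SecondCountableTopology X]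
  [ChartedSpace (EuclideanSpace ℝ (Fin 4)) X] [IsManifold (𝓡 4) ∞ X] [CompactSpace X]

/-- **Kim–Yamada's Corollary C on the whole window, granted Gompf's three topological leaves**:
every Cappell–Shaneson homotopy 4-sphere of a matrix `A ∈ SL(3, ℤ)` with `det (A - 1) = 1` and
`-64 ≤ tr A ≤ 69` is diffeomorphic to `S⁴` — with Theorem B there PROVED
(`gompfConjectureForTrace_of_mem_Icc_neg_sixtyfour_sixtynine`); the leaves are the named facts
`gompf2010_deltaMove`, `gompf2010_akbulutKirby_framings`, `akbulutKirby1979_sphere_four` of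
`CappellShanesonGompfReduction.lean`. [cite: KimYamada2023, Cor. C and Remark 1.1 (§1.2)] -/
theorem nonempty_diffeomorph_sphere_four_of_trace_mem_Icc_neg_sixtyfour_sixtynine
    (hΔ : gompf2010_deltaMove.{u}) (h43 : gompf2010_akbulutKirby_framings.{0, 0})
    (hAK : akbulutKirby1979_sphere_four) {A : SL(3, ℤ)}
    (hdet : ((A : Matrix (Fin 3) (Fin 3) ℤ) - 1).det = 1)
    (htr : Matrix.trace (A : Matrix (Fin 3) (Fin 3) ℤ) ∈ Icc (-64 : ℤ) 69)
    (hX : IsCappellShanesonSphereOf A X) :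
    Nonempty (X ≃ₘ⟮𝓡 4, 𝓡 4⟯ (Metric.sphere (0 : EuclideanSpace ℝ (Fin (4 + 1))) 1)) :=
  nonempty_diffeomorph_sphere_four_of_gompfConjectureForTrace X hΔ h43 hAK
    (gompfConjectureForTrace_of_mem_Icc_neg_sixtyfour_sixtynine htr) hdet rfl hX

end SpheresFinal

/-- **The named fact (Kim–Yamada's Cor. C on `[-64, 69]`) from Gompf's three topological leaves
ALONE** — all of its number theory (Theorem B on the whole window) is now proved in the tree.
[cite: KimYamada2023, Thm. B and Cor. C (§1.2, §6.1)] -/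
theorem kimYamada2023_nonempty_diffeomorph_sphere_four_of_trace_mem_Icc_of_leaves
    (hΔ : gompf2010_deltaMove.{u}) (h43 : gompf2010_akbulutKirby_framings.{0, 0})
    (hAK : akbulutKirby1979_sphere_four) :
    kimYamada2023_nonempty_diffeomorph_sphere_four_of_trace_mem_Icc.{u} :=
  kimYamada2023_nonempty_diffeomorph_sphere_four_of_trace_mem_Icc_of_fiftyeight hΔ h43 hAK
    gompfConjectureForTrace_fiftyeight

end Literature.Topology.FourManifolds

end
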